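import Summits.ValiantsHypothesis.ValiantsHypothesis.Theorems.BinomialElusivePeelingLemmaWindowCalculus

/-!
# The ± decomposition of a two-sided edge combination along one arm

Helper for the crux stmt-ValiantsHypothesis-7391 (negative lane; `Cruxes/PeelingLemma/DETERMINISTIC-ALLX.md`
§3g, identities (a) of the proof of the gadget local lemma [E]).  Along an arm with birth sequence
`f` and windows `W t = win f q t`, an edge `t` (joining positions `t`, `t+1`) with coefficients `u t`
(output `ψ(lower) + ψ'(upper)`) and `v t` (output `ψ'(lower) + ψ(upper)`) contributes
`u t • W t + v t • W (t+1)` to the `ψ`-alphabet and `v t • W t + u t • W (t+1)` to the `ψ'`-alphabet.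
Identifying the two alphabets: the SUM of the two sides is `Σ (u+v) t • (W t + W (t+1))`, i.e. by the
pair-label identity a combination of the indicators of the born letter `f (t+1)` and the dying letter
`f (t-2q)` (`side_add_eq`) — a purely local object; the DIFFERENCE is `Σ (u-v) t • (W t - W (t+1))`
(`side_sub_eq`), which Abel summation turns into a vertex-charge combination with charges
`d t - d (t-1)`, `d = u - v`, plus boundary terms (`sum_mul_sub_succ_eq`).  No Theses import.
-/

namespace Summit.ValiantsHypothesis.ValiantsHypothesis.Theorems.PeelingLemmaWindow

-- summit = sub-problem name (single-conjunct summit, D-0017 layout), so the namespace repeats it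
set_option linter.dupNamespace false

open scoped BigOperators
open Finset

variable {Λ : Type*} [DecidableEq Λ]

/-- **Sum of the two sides = pair labels.**  `Σ_t (u t W t + v t W (t+1)) + Σ_t (v t W t + u t W (t+1))
= Σ_t (u t + v t) ([f (t+1) = ν] + [f (t-2q) = ν])`. -/
theorem side_add_eq (f : ℤ → Λ) (q : ℕ) (E : Finset ℤ) (u v : ℤ → ℤ) (ν : Λ) :
    (∑ t ∈ E, (u t * win f q t ν + v t * win f q (t + 1) ν)) +
        ∑ t ∈ E, (v t * win f q t ν + u t * win f q (t + 1) ν) =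
      ∑ t ∈ E, (u t + v t) *
        ((if f (t + 1) = ν then 1 else 0) + (if f (t - 2 * q) = ν then 1 else 0)) := by
  rw [← Finset.sum_add_distrib]
  refine Finset.sum_congr rfl fun t _ => ?_
  rw [← win_add_win_succ f q t ν]
  ring

/-- **Difference of the two sides.**  `Σ_t (u t W t + v t W (t+1)) - Σ_t (v t W t + u t W (t+1))
= Σ_t (u t - v t) (W t - W (t+1))`. -/
theorem side_sub_eq (f : ℤ → Λ) (q : ℕ) (E : Finset ℤ) (u v : ℤ → ℤ) (ν : Λ) :
    (∑ t ∈ E, (u t * win f q t ν + v t * win f q (t + 1) ν)) -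
        ∑ t ∈ E, (v t * win f q t ν + u t * win f q (t + 1) ν) =
      ∑ t ∈ E, (u t - v t) * (win f q t ν - win f q (t + 1) ν) := by
  rw [← Finset.sum_sub_distrib]
  refine Finset.sum_congr rfl fun t _ => ?_
  ring

/-- Each side is recovered from the sum and the difference: `2 S¹ = S⁺ + S⁻`. -/
theorem two_mul_side_one (S₁ S₂ : ℤ) : 2 * S₁ = (S₁ + S₂) + (S₁ - S₂) := by ring

/-- … and `2 S² = S⁺ - S⁻`. -/
theorem two_mul_side_two (S₁ S₂ : ℤ) : 2 * S₂ = (S₁ + S₂) - (S₁ - S₂) := by ring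

/-- Support count behind §3g COUNT: if `S⁺ ≠ 0` then `S¹ ≠ 0 ∨ S² ≠ 0`; if `S⁺ = 0` and `S⁻ ≠ 0` then
both `S¹ ≠ 0` and `S² ≠ 0`. -/
theorem sides_ne_zero_of_sum_sub (S₁ S₂ : ℤ) :
    (S₁ + S₂ ≠ 0 → S₁ ≠ 0 ∨ S₂ ≠ 0) ∧ (S₁ + S₂ = 0 → S₁ - S₂ ≠ 0 → S₁ ≠ 0 ∧ S₂ ≠ 0) := by
  constructor
  · intro h; by_contra hc; push Not at hc; exact h (by rw [hc.1, hc.2, add_zero])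
  · intro h1 h2; constructor <;> intro h0 <;> apply h2 <;> linarith

/-- **Abel summation for the difference.**  For consecutive edges `a, a+1, …, a+n-1` (as integers):
`Σ_{i<n} d (a+i) (W (a+i) - W (a+i+1)) = d a · W a + Σ_{1 ≤ i < n} (d (a+i) - d (a+i-1)) W (a+i)
 - d (a+n-1) W (a+n)` — written with the convention `d (a-1) = 0` folded into the first term, as
`Σ_{i<n} (d (a+i) - d' i) W (a+i) - d (a+n-1) W (a+n)` where `d' 0 = 0`, `d' (i+1) = d (a+i)`. -/
theorem sum_mul_sub_succ_eq (W : ℤ → ℤ) (d : ℤ → ℤ) (a : ℤ) (n : ℕ) :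
    ∑ i ∈ Finset.range n, d (a + i) * (W (a + i) - W (a + i + 1)) =
      (∑ i ∈ Finset.range n, (d (a + i) - (if i = 0 then 0 else d (a + i - 1))) * W (a + i)) -
        (if n = 0 then 0 else d (a + n - 1) * W (a + n)) := by
  induction n with
  | zero => simp
  | succ n ih =>
    rw [Finset.sum_range_succ, Finset.sum_range_succ, ih]
    rcases Nat.eq_zero_or_pos n with rfl | hn
    · simp; ring
    · rw [if_neg (by omega), if_neg (by omega), if_neg (by omega)]
      have h1 : (a + ((n + 1 : ℕ) : ℤ) - 1) = a + (n : ℤ) := by push_cast; ring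
      have h2 : (a + (n : ℤ) - 1) = a + ((n - 1 : ℕ) : ℤ) := by
        rw [Nat.cast_sub hn]; push_cast; ring
      have h3 : a + (n : ℤ) + 1 = a + ((n + 1 : ℕ) : ℤ) := by push_cast; ring
      rw [h1, h2, h3]
      ring

end Summit.ValiantsHypothesis.ValiantsHypothesis.Theorems.PeelingLemmaWindow
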